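import Summits.QuantumFields.BalabanUV.Beta.GAN24.BornLambdaContactLineage
import Summits.QuantumFields.BalabanUV.Beta.GAN24.BornLambdaBracketLetter
import Summits.QuantumFields.BalabanUV.Beta.GAN24.BornLambdaLettersPoly

/-!
# `GAN24.BornLambdaContactBound` — CT-ROUTE, the row owner's `gen20/BORNSEC-PLAN-v1.md` v1.1 §A (Λ-C) **(C4) PART 5, THE END: THE CONTACT LETTER `hCg` OF THE Λ-BORN ROW
# AT `d = 3`** — for `2 ≤ Lc`, every `cΛ` and every weight base at the pin `|cE| ≤ Lc^4`, there are `C ≥ 0`, `δ > 0` such that for EVERY in-block root and EVERY lineage `i < k`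
# `LocStencil (fun κ′ u′ ↦ (cE·Lc^8)^{k−i} • (push₃ T_i T_i T_i S_i − push₃ B_i B_i B_i S_i) κ′ u′) (C·(k−i)^1·(Lc⁻¹)^{k−i}) δ` — LITERALLY the binder `hCg` (with `p = 1`, `θ = Lc⁻¹`) of
# leaf-03 g54's `BornLambdaLettersPoly.exists_hBLam_of_polyGeometric_three`; PART 4's lineage count with every letter DISCHARGED from the tree: (N1) `RespStepDecay.exists_respStep_decay_and_grad`,
# leaf-01's `DressedLegEnvelope.exists_legChain_envelope` ∕ `BornLambdaContactCells.exists_abs_lineageGauge_le` ∕ §1 (coefficient decay + transversality), gan24-p2 g33's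
# `BornLambdaBracketLetter.exists_bracket_bornLam_zero∕succ_letter_three` (the tent, (C2))  (OWNER gan24-p1-g21 [GAN24P1-G21-ONLINE] (W1) «(C4) IS YOURS»; journal l.34168 ∕ l.34465)

HONEST FRAMING (cell charter, verbatim): «discharging `BetaPertH` makes Bałaban's UV stability UNCONDITIONAL — a real constructive-QFT result;
it is NOT the continuum limit and NOT the Clay problem.»  DERIVED cell leaf (pub-balaban, G-an2-4 formalisation swarm → CRUX TEAM (2), seat
`b2b-balaban-gan24-formalise-leaf-02`, gen 49): NOT IN PRINT — OUR PROOF of the (C4) letter ([folklore] bookkeeping over PARTs 1–4 and the tree letters named above BY NAME);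
NO cited fact, NO `def`, NO `def … : Prop`, NO sorry, NO wall binder, NO hypothesis beyond `2 ≤ Lc` and the pin `|cE| ≤ Lc^4`.
WHAT THIS DISCHARGES AND WHAT NOT: the binder `hCg` (Λ half, CONTACT letter) of `exists_hBLam_of_polyGeometric_three` — ONE of its two letters; the other (`hUg`, the undressed rows at the
in-block root) is the OWNER's `BornLambdaUndressedRow` ∕ the rooted road-S3 rows (W4)(W5); the V half, `hB`, `hS0` for the comb family, (CONV-C) are NOT touched.  NEVER «G-an2-4 closed»
as (CONV-C); NOT hS0, NOT D1, NOT `BetaPertH`, NOT continuum, NOT Clay.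
HONEST DEPENDENCY (cell records, verbatim): «continuum YM on T⁴ ⇐ BetaPertH ∧ nine spine estimates (0/9 proved); BetaPertH ⇐ (D1) ∧ (D4) ∧ CAP+tail;
G-an2-4 gates asym, D1 and NE2/3/4.»
ABSOLUTE RULE (cell charter, verbatim): «No internally-minted statement may enter as a cited fact. Every hypothesis is either kernel-proved in this
package or a verbatim quotation of a PUBLISHED theorem with page reference. The manuscript(s) under audit are NOT citable for their own disputed steps —
they are the thing under adjudication; programme-internal (2001/route/tribunal) claims are never citable.»

## What is proved (`d = 3`, `2 ≤ Lc`)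
* §1 `bracket_letter_mono` (weakening a bracket letter in constant and rate).
* §2 **`exists_hCg_three`** — the statement in the title, for all `cE` with `|cE| ≤ Lc^4` and all `cΛ`; constants `C = C(Lc, cΛ, tree letters)`, `θ = Lc⁻¹`, `δ = min(δ_br, κ₁)∕48`.
Provenance: seat b2b-balaban-gan24-formalise-leaf-02 gen 49 (prover-…-leaf-02-g49-0), 2026-08-21; over the files named above BY NAME.
-/

noncomputable section

open Finset
open scoped BigOperators
open Literature.MathematicalPhysics.QuantumFieldTheory
open Literature.MathematicalPhysics.QuantumFieldTheory.LatticeForm (quo)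
open Literature.MathematicalPhysics.QuantumFieldTheory.Balaban1983to89
open Literature.MathematicalPhysics.QuantumFieldTheory.Balaban1983to89.Beta
open B4ContourShift (supNorm supNorm_nonneg)
open B12Sec2to5 (l1 l1_nonneg)
open ExpKernelCalculus (MKer Zl Zl_nonneg)
open AffineAveraging (Site box toSite)
open AveragingHessianKernels (ell)
open OneStepResolventKernel (Fib LocStencil KInv)
open BalabanStepJetsSucc (E2 lamCoeffK)
open BalabanStepJets (lamCoeffOf)
open BalabanCompositeJets (respStep)
open Summit.QuantumFields.BalabanUV.Beta.HessKerDressedUnits (unitS)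
open Summit.QuantumFields.BalabanUV.Beta.GAN24.CombesThomas (sfStep smStep KStepUnit)
open Summit.QuantumFields.BalabanUV.Beta.GAN24.RespStepBmDecompExact (respStepBmSeq)
open Summit.QuantumFields.BalabanUV.Beta.GAN24.Push4Iter (legChain)
open Summit.QuantumFields.BalabanUV.Beta.GAN24.Push3 (push₃)
open Summit.QuantumFields.BalabanUV.Beta.GAN24.SrecBornSector (freshAt)
open Summit.QuantumFields.BalabanUV.Beta.GAN24.RespStepDecay (exists_respStep_decay_and_grad)
open Summit.QuantumFields.BalabanUV.Beta.GAN24.UndressedResponseUnits (inv_cast_pow_pow)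
open Summit.QuantumFields.BalabanUV.Beta.GAN24.DressedLegEnvelope (exists_legChain_envelope)
open Summit.QuantumFields.BalabanUV.Beta.GAN24.FibreStrip (unitDecayK_holds)
open Summit.QuantumFields.BalabanUV.Beta.GAN24.BornLambdaContactCells (unitS_freshAt_lam_zero_eq_SLam unitS_freshAt_lam_succ_eq_SLam divV_bornLam_zero_eq_zero
  divV_bornLam_succ_eq_zero exists_abs_bornLamCoeff_zero_le abs_bornLamCoeff_succ_le_of_unitDecayK exists_abs_lineageGauge_le)
open Summit.QuantumFields.BalabanUV.Beta.GAN24.BornLambdaBracketLetter (exists_bracket_bornLam_zero_letter_three exists_bracket_bornLam_succ_letter_three)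
open Summit.QuantumFields.BalabanUV.Beta.GAN24.ContactLambdaCellBound (exp_env_mono_rate)
open Summit.QuantumFields.BalabanUV.Beta.GAN24.BornLambdaContactLineage (abs_weight_mul_contact_le_three)

namespace Summit.QuantumFields.BalabanUV.Beta.GAN24.BornLambdaContactBound

variable {Lc : ℕ} [NeZero Lc]

/-! ## §1 Weakening a bracket letter -/

omit [NeZero Lc] in
/-- [folklore] A bracket letter `|X| ≤ |cΛ|·C·q⁻¹·e^{−δ·s}` weakens to any larger constant and any slower rate (`s ≥ 0`, `q⁻¹ ≥ 0`). -/
theorem bracket_letter_mono {X cΛ C C' δ δ' qi s : ℝ} (hC : C ≤ C') (hδ : δ' ≤ δ) (hqi : 0 ≤ qi) (hs : 0 ≤ s)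
    (h : |X| ≤ |cΛ| * C * qi * Real.exp (-(δ * s))) : |X| ≤ |cΛ| * C' * qi * Real.exp (-(δ' * s)) := by
  have hC0 : 0 ≤ |cΛ| * C * qi := by
    have h1 : 0 ≤ |cΛ| * C * qi * Real.exp (-(δ * s)) := (abs_nonneg _).trans h
    exact nonneg_of_mul_nonneg_left (by rwa [mul_comm] at h1) (Real.exp_pos _)
  refine h.trans ?_
  calc |cΛ| * C * qi * Real.exp (-(δ * s)) ≤ |cΛ| * C * qi * Real.exp (-(δ' * s)) := mul_le_mul_of_nonneg_left (exp_env_mono_rate hδ hs) hC0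
    _ ≤ |cΛ| * C' * qi * Real.exp (-(δ' * s)) := by
        have : |cΛ| * C * qi ≤ |cΛ| * C' * qi := mul_le_mul_of_nonneg_right (mul_le_mul_of_nonneg_left hC (abs_nonneg _)) hqi
        exact mul_le_mul_of_nonneg_right this (Real.exp_pos _).le

/-! ## §2 The contact letter `hCg` of the Λ-born row -/

/-- NOT IN PRINT; OUR PROOF (the (C4) letter of BORNSEC-PLAN v1.1 §A (Λ-C); `d = 3`, `2 ≤ Lc`).  **THE CONTACT LETTER `hCg` OF THE Λ-BORN ROW**: for every `cΛ` and every weight base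
at the pin `|cE| ≤ Lc^4` there are `C ≥ 0` and `δ > 0` such that, with `θ = Lc⁻¹ ∈ [0,1)`, for EVERY in-block root `rr ∈ box (3+1) Lc` and EVERY lineage `i < k`,
`LocStencil (fun κ′ u′ ↦ (cE·Lc^8)^{k−i} • (push₃ T_i T_i T_i S_i − push₃ B_i B_i B_i S_i) κ′ u′) (C·((k−i)^1·θ^{k−i})) δ`
(`T_i = legChain (respStepBmSeq ρ Lc) i (k−1−i)`, `B_i = respStep (Lc^i) (Lc^k)`, `S_i = unitS_i (freshAt Lc ρ 0 cΛ i)`) — LITERALLY the binder `hCg` of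
`BornLambdaLettersPoly.exists_hBLam_of_polyGeometric_three` with `p = 1`.  Letters: (N1), the dressed envelope, the gauge sup, the born coefficients' decay ∕ transversality
(`BornLambdaContactCells` §1) and gan24-p2's bracket letters (one `(C, δ)` for member `0`, one for all members `j+1`, merged by `max`∕`min`); the count is PART 4. -/
theorem exists_hCg_three (hLc : 2 ≤ Lc) (cE cΛ : ℝ) (hcE : |cE| ≤ (Lc : ℝ) ^ 4) :
    ∃ C θ δ : ℝ, 0 ≤ C ∧ 0 ≤ θ ∧ θ < 1 ∧ 0 < δ ∧ ∀ (rr : Fin (3 + 1) → ℕ), rr ∈ box (3 + 1) Lc → ∀ k i : ℕ, i < k →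
      LocStencil (fun κ' u' => (cE * (Lc : ℝ) ^ (2 * (3 + 1))) ^ (k - i) •
        (push₃ (legChain (respStepBmSeq (toSite rr) Lc) i (k - 1 - i)) (legChain (respStepBmSeq (toSite rr) Lc) i (k - 1 - i))
            (legChain (respStepBmSeq (toSite rr) Lc) i (k - 1 - i)) (unitS (sfStep Lc i) (smStep 3 Lc i) (freshAt Lc (toSite rr) 0 cΛ i)) κ' u'
          - push₃ (respStep (d := 3) (Lc ^ i) (Lc ^ k)) (respStep (d := 3) (Lc ^ i) (Lc ^ k)) (respStep (d := 3) (Lc ^ i) (Lc ^ k))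
            (unitS (sfStep Lc i) (smStep 3 Lc i) (freshAt Lc (toSite rr) 0 cΛ i)) κ' u')) (C * (((k - i : ℕ) : ℝ) ^ 1 * θ ^ (k - i))) δ := by
  have hLc1 : 1 ≤ Lc := le_trans (by norm_num) hLc
  have hL : (0 : ℝ) < (Lc : ℝ) := Nat.cast_pos.2 (Nat.pos_of_ne_zero (NeZero.ne Lc))
  -- the tree letters, constants outside every ∀
  obtain ⟨κ₁, C₁, -, hκ₁, hC₁, -, hN1raw, -⟩ := exists_respStep_decay_and_grad (Lc := Lc)
  have hN1 : ∀ (m k : ℕ) (μ : Fin (3 + 1)) (z : Site (3 + 1)) (l'' : Fin (3 + 1)) (w' : Site (3 + 1)),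
      |respStep (d := 3) (Lc ^ m) (Lc ^ (m + k + 1)) μ z l'' w'| ≤
        C₁ * ((Lc : ℝ) ^ (5 * (k + 1)))⁻¹ * Real.exp (-(κ₁ * supNorm (quo (Lc ^ (k + 1)) w' - z))) := by
    intro m k μ z l'' w'
    have h := hN1raw m k μ z l'' w'
    rwa [inv_cast_pow_pow] at h
  obtain ⟨κE, KE, hκE, -, hEnv⟩ := exists_legChain_envelope (Lc := Lc) hLc
  obtain ⟨Klam, -, hKlam⟩ := exists_abs_lineageGauge_le (Lc := Lc) hLc
  obtain ⟨C0, δ0, hC0, hδ0, hb0⟩ := exists_bracket_bornLam_zero_letter_three (Lc := Lc) hLc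
  obtain ⟨Cs, δs, hCs, hδs, hbs⟩ := exists_bracket_bornLam_succ_letter_three (Lc := Lc) hLc
  set Cbr : ℝ := max C0 Cs with hCbr
  set δbr : ℝ := min δ0 δs with hδbr
  have hCbr0 : 0 ≤ Cbr := hC0.trans (le_max_left _ _)
  have hδbr0 : 0 < δbr := lt_min hδ0 hδs
  set κ : ℝ := min δbr κ₁ with hκdef
  have hκ : 0 < κ := lt_min hδbr0 hκ₁
  have hTb : 0 ≤ |cΛ| * Cbr := mul_nonneg (abs_nonneg _) hCbr0
  -- the constants
  refine ⟨(Lc : ℝ) ^ 3 * ((2 * (Lc : ℝ) ^ (3 + 1))⁻¹ * (((3 : ℝ) + 1) * (|cΛ| * Cbr) * (Real.exp (2 * ((3 : ℝ) + 1) * κ) ^ 2 *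
              (((2 * Lc : ℕ) : ℝ) ^ (3 + 1) * (((3 + 1 : ℕ) : ℝ) * ((Lc : ℝ) ^ (3 + 1) * (ell (3 + 1) Lc : ℝ))))))
            * (C₁ ^ 2 * ((Lc : ℝ) * (64 + 544 * Lc + 768 * (Lc : ℝ) ^ 2))) * Zl (3 + 1) (κ / (4 * ((3 : ℝ) + 1)))),
    (Lc : ℝ)⁻¹, κ / 12 / ((3 : ℝ) + 1), ?_, (inv_pos.2 hL).le, ?_, by positivity, ?_⟩
  · have hz : 0 ≤ Zl (3 + 1) (κ / (4 * ((3 : ℝ) + 1))) := Zl_nonneg (by positivity)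
    positivity
  · have h2 : (2 : ℝ) ≤ Lc := by exact_mod_cast hLc
    rw [inv_lt_one_iff₀]; right; linarith
  intro rr hrr k i hik κ' u' x z a b
  obtain ⟨n, rfl⟩ : ∃ n, k = i + n + 1 := ⟨k - i - 1, by omega⟩
  have e1 : i + n + 1 - 1 - i = n := by omega
  have e2 : i + n + 1 - i = n + 1 := by omega
  -- the lineage's letters with explicit constants
  have hE : ∀ μ z' l u, |legChain (respStepBmSeq (d := 3) (toSite rr) Lc) i n μ z' l u|
      ≤ (KE * ((Lc : ℝ) ^ (4 * (n + 1)))⁻¹) * Real.exp (-(κE * supNorm (quo (Lc ^ (n + 1)) u - z'))) :=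
    fun μ z' l u => hEnv rr hrr i n μ z' l u
  have hlam : ∀ μ z' u, |(RespStepBmDecompPsi.Psi (toSite rr) Lc i n (KKTFluctuationKernel.delta1 μ z')
      - AxialProjectorBlockMean.bmGaugeAt (toSite rr) (respStep (d := 3) (Lc ^ i) (Lc ^ (i + n + 1)) μ z') Lc) u|
        ≤ Klam * ((Lc : ℝ) ^ (4 * (n + 1)))⁻¹ := fun μ z' u => hKlam rr hrr i n μ z' u
  have hqi : 0 ≤ ((((Lc : ℝ) ^ n) ^ (2 * 3 + 1))⁻¹) := by positivity
  cases i with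
  | zero =>
    -- member 0: coefficients `cΛ·lamCoeffOf (KInv Lc) Lc`
    obtain ⟨Cc, δc, hδc, hCc, hc⟩ := exists_abs_bornLamCoeff_zero_le (d := 3) (Lc := Lc) cΛ
    rw [unitS_freshAt_lam_zero_eq_SLam]
    have hbr : ∀ (κ' : Fin (3 + 1)) (u' : Site (3 + 1)) μ y,
        |∑' u, ∑ l, legChain (respStepBmSeq (d := 3) (toSite rr) Lc) 0 n κ' u' l u * (cΛ * lamCoeffOf (KInv (N := Lc) (d := 3)) Lc μ y l u)|
          ≤ |cΛ| * Cbr * ((((Lc : ℝ) ^ n) ^ (2 * 3 + 1))⁻¹) * Real.exp (-(δbr * supNorm (quo (Lc ^ n) y - u'))) := by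
      intro κ' u' μ y
      have h := hb0 rr hrr cΛ (0 + n + 1) κ' u' μ y
      rw [show 0 + n + 1 - 1 - 0 = n by omega] at h
      exact bracket_letter_mono (le_max_left _ _) (min_le_left _ _) hqi (supNorm_nonneg _) h
    have H := abs_weight_mul_contact_le_three hLc hrr hcE hN1 hκ₁ hC₁ hE hκE hlam hc hδc hCc (divV_bornLam_zero_eq_zero hrr cΛ) hbr hδbr0 hTb
      κ' u' x z a b
    simpa only [e1, e2, Pi.smul_apply, Pi.sub_apply, smul_eq_mul, pow_one, Nat.cast_succ] using H
  | succ j =>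
    -- member j+1: coefficients `(cΛ·Lc^8)·lamCoeffK (KStepUnit Lc (j+1)) ((smStep j)²•E2 (j+1)) Lc`
    obtain ⟨κK, hκK, Cst, hK⟩ := unitDecayK_holds (Lc := Lc)
    have hrate : 0 < κK / ((3 + 1) * (Lc : ℝ)) := by positivity
    have hrate2 : 0 < κK / ((3 + 1) * (Lc : ℝ)) / 2 := by positivity
    have hCc : 0 ≤ |cΛ * (Lc : ℝ) ^ (2 * (3 + 1))| * ((Fintype.card (Fib 3) : ℝ) * (Cst * Real.exp (2 * κK) * (Cst * Real.exp (2 * κK)))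
        * Zl (3 + 1) (κK / ((3 + 1) * (Lc : ℝ)) - κK / ((3 + 1) * (Lc : ℝ)) / 2)) := by
      have hz : 0 ≤ Zl (3 + 1) (κK / ((3 + 1) * (Lc : ℝ)) - κK / ((3 + 1) * (Lc : ℝ)) / 2) := Zl_nonneg (by linarith)
      have hsq : 0 ≤ Cst * Real.exp (2 * κK) * (Cst * Real.exp (2 * κK)) := mul_self_nonneg _
      positivity
    rw [unitS_freshAt_lam_succ_eq_SLam]
    have hbr : ∀ (κ' : Fin (3 + 1)) (u' : Site (3 + 1)) μ y,
        |∑' u, ∑ l, legChain (respStepBmSeq (d := 3) (toSite rr) Lc) (j + 1) n κ' u' l u *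
            ((cΛ * (Lc : ℝ) ^ (2 * (3 + 1))) * lamCoeffK (KStepUnit (d := 3) Lc (j + 1)) ((smStep 3 Lc j) ^ 2 • E2 3 Lc (j + 1)) Lc μ y l u)|
          ≤ |cΛ| * Cbr * ((((Lc : ℝ) ^ n) ^ (2 * 3 + 1))⁻¹) * Real.exp (-(δbr * supNorm (quo (Lc ^ n) y - u'))) := by
      intro κ' u' μ y
      have h := hbs rr hrr cΛ j (j + 1 + n + 1) κ' u' μ y
      rw [show j + 1 + n + 1 - 1 - (j + 1) = n by omega] at h
      exact bracket_letter_mono (le_max_right _ _) (min_le_right _ _) hqi (supNorm_nonneg _) h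
    have H := abs_weight_mul_contact_le_three hLc hrr hcE hN1 hκ₁ hC₁ hE hκE hlam (abs_bornLamCoeff_succ_le_of_unitDecayK (d := 3) hK hrate cΛ j)
      hrate2 hCc (divV_bornLam_succ_eq_zero hrr cΛ j) hbr hδbr0 hTb κ' u' x z a b
    simpa only [e1, e2, Pi.smul_apply, Pi.sub_apply, smul_eq_mul, pow_one, Nat.cast_succ] using H

end Summit.QuantumFields.BalabanUV.Beta.GAN24.BornLambdaContactBound

end
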